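import Mathlib
import HarnessLib
import Summits.Ventures.LatticeQCDFlow.Scaling.U1IdentityFlowStrict
import Summits.Ventures.LatticeQCDFlow.Scaling.WilsonIdentityFlowLaw
import Summits.Ventures.LatticeQCDFlow.Scaling.AcceptanceBhattacharyyaRigidityPi
import Summits.Ventures.LatticeQCDFlow.Scaling.AcceptanceVolumeFloorRigidityPiEq

/-!
# LatticeQCDFlow / Scaling — the untrained (identity-flow) exact samplers are GRADED, so the strict
# volume laws apply to them: `acc_V < (I₀(β/2)²/I₀(β))^V`, `acc₁^V < acc_V`, `acc < Z(β/2)²/Z(β)`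

HONEST FRAMING: exact (Metropolis-corrected) sampling algorithms for lattice gauge theory;
figures of merit are autocorrelation/cost numbers at stated couplings and volumes; no
continuum-physics claim.

Venture `LatticeQCDFlow` (cell pub-lqcd), topic `Scaling`; FANOUT row 3 (`s0-u1-a`, S0-B
implementation A, GEN-14).  NEW WORK of the cell (elementary), instantiating row 3's general-space
rigidity theorems (`Scaling/AcceptanceBhattacharyyaRigidityIntegral`, `…BhattacharyyaRigidityPi`,
`…VolumeFloorRigidityPiEq`, imported) at row 3's closed-form UNTRAINED baselines
(`Scaling/U1IdentityFlowVolumeLaw` / `U1IdentityFlowStrict`: `V` independent U(1) plaquette angles,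
Wilson density `e^{β cos θ}/(2πI₀(β))` against the Haar density `1/(2π)` on `(0, 2π]`;
`Scaling/WilsonIdentityFlowLaw`: the Boltzmann tilt `e^{−βS}/Z_μ(β)` of ANY compact gauge group
against a reference probability law `μ`, model density `1`).  "Hit-or-miss a.e." is
`∃ c, ∀ᵐ x, 0 < p x → p x / q x = c`.  NO definition is introduced.

* §1 the bridge **`hitOrMiss_ae_iff_ae_eq_of_pos`** — for a FULLY SUPPORTED target (`p > 0`
  everywhere) and a normalised positive model, hit-or-miss a.e. means PERFECT (`p = q` a.e.): an
  all-or-nothing proposal that never misses is exact.  Hence every imperfect fully supported flow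
  is graded and all of row 3's strict laws apply to it;
* §2 ANY compact gauge group (untrained Wilson sampler of theory-2's `ConstructiveQFTWave0`, reference
  law `μ`): **`wilsonIdentityFlow_hitOrMiss_ae_iff`** (hit-or-miss a.e. iff the tilt `e^{−βS}/Z` is
  `μ`-a.e. `1`), **`wilsonIdentityFlow_essFrac_lt_one_iff`** (`Z(β)²/Z(2β) < 1` iff the tilt is not
  `μ`-trivial) and **`wilsonIdentityFlow_meanAccept_lt`** (then `acc < Z(β/2)²/Z(β)` STRICTLY);
* §2′ `μ = Haar^{⊗E}` UNCONDITIONALLY: **`wilsonTilt_not_ae_one_haar`** — for `β ≠ 0` and an action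
  that is not identically zero the tilt is non-trivial (continuity of `S`, `S(1) = 0`, product Haar
  measure charges open sets), hence **`wilsonIdentityFlow_essFrac_lt_one_haar`** (`Z(β)² < Z(2β)`) and
  **`wilsonIdentityFlow_meanAccept_lt_haar`** (`acc < Z(β/2)²/Z(β)`, `Z = partitionFunction`);
* §3 U(1), `β ≠ 0`, UNCONDITIONALLY (row 3's `not_u1Wilson_ae_eq_u1Haar`):
  **`not_hitOrMiss_u1Wilson`**; one plaquette `u1IdentityFlow_meanAccept_one_lt`
  (`acc₁ < I₀(β/2)²/I₀(β)`); `V = card ι ≥ 1` plaquettes **`u1IdentityFlow_meanAccept_lt_pow`**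
  (`acc_V < (I₀(β/2)²/I₀(β))^V`, row 3's `meanAccept_pi_const_lt_pow`); `V ≥ 2` plaquettes
  **`u1IdentityFlow_pow_meanAccept_lt`** (`acc₁^V < acc_V`, row 3's `prod_meanAccept_lt_meanAccept_pi`):
  GEN-12's sandwich `(8/9)(I₀(β)²/I₀(2β))^V ≤ acc_V ≤ (I₀(β/2)²/I₀(β))^V` is strict above and the
  untrained acceptance is strictly super-multiplicative in the volume.

Reading (value-free): the untrained exact sampler of a Wilson lattice gauge theory is never an
all-or-nothing proposal unless it is already exact, so its equilibrium acceptance lies strictly below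
the Bhattacharyya ceiling `Z(β/2)²/Z(β)` whenever the Boltzmann tilt is non-trivial, and for
independent U(1) plaquettes at `β ≠ 0` strictly between `acc₁^V` and `(I₀(β/2)²/I₀(β))^V`.
NOT CLAIMED: which groups / representations / dimensions have a not identically vanishing action
(hypothesis `∃ U₀, S(U₀) ≠ 0` of §2′ — immediate for a non-trivial `ρ` and `d ≥ 2`, not typed); the
SU(2) class-angle chart (its Haar class density vanishes at the endpoints, outside the positive-model
setting); any acceptance VALUE of ours; nothing re-scored.
-/

noncomputable section

namespace Summit.Ventures.LatticeQCDFlow.Theory2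

open MeasureTheory Real Set Finset Filter
open Literature.Analysis.FunctionSpaces (besselI besselI_zero_pos)
open Literature.MathematicalPhysics.QuantumFieldTheory
open Summit.Ventures.LatticeQCDFlow.Scoring (onePlaquetteZ onePlaquetteZ_pos)

/-! ## §1 A fully supported hit-or-miss flow is perfect -/

section Bridge

variable {X : Type*} [MeasurableSpace X] {μ : Measure X} {p q : X → ℝ}

/-- **HIT-OR-MISS WITH FULL SUPPORT MEANS PERFECT.**  For a target density `p > 0` everywhere with
`∫ p = 1` and a model `q > 0` with `∫ q = 1`: the pair is hit-or-miss a.e.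
(`p/q` a.e. constant on `{p > 0}`) iff `p = q` almost everywhere. [ours] -/
theorem hitOrMiss_ae_iff_ae_eq_of_pos (hp : ∀ x, 0 < p x) (hp1 : ∫ x, p x ∂μ = 1)
    (hq : ∀ x, 0 < q x) (hq1 : ∫ x, q x ∂μ = 1) :
    (∃ c : ℝ, ∀ᵐ x ∂μ, 0 < p x → p x / q x = c) ↔ p =ᵐ[μ] q := by
  constructor
  · rintro ⟨c, hc⟩
    have hpc : p =ᵐ[μ] fun x => c * q x := hc.mono fun x hx => by
      have h := hx (hp x)
      rwa [div_eq_iff (hq x).ne'] at h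
    have hc1 : c = 1 := by
      have h1 : ∫ x, p x ∂μ = ∫ x, c * q x ∂μ := integral_congr_ae hpc
      rw [integral_const_mul, hp1, hq1, mul_one] at h1
      exact h1.symm
    exact hpc.trans (Eventually.of_forall fun x => by
      show c * q x = q x
      rw [hc1, one_mul])
  · intro h
    exact ⟨1, h.mono fun x hx _ => by rw [hx, div_self (hq x).ne']⟩

/-- **An imperfect fully supported flow is graded** (not hit-or-miss a.e.). [ours] -/
theorem not_hitOrMiss_ae_of_not_ae_eq (hp : ∀ x, 0 < p x) (hp1 : ∫ x, p x ∂μ = 1)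
    (hq : ∀ x, 0 < q x) (hq1 : ∫ x, q x ∂μ = 1) (h : ¬ p =ᵐ[μ] q) :
    ¬ ∃ c : ℝ, ∀ᵐ x ∂μ, 0 < p x → p x / q x = c :=
  fun hc => h ((hitOrMiss_ae_iff_ae_eq_of_pos hp hp1 hq hq1).1 hc)

end Bridge

/-! ## §2 The untrained Wilson sampler of any compact gauge group -/

section Wilson

variable {d L N : ℕ} [NeZero L] {G : Type*} [Group G] [TopologicalSpace G] [IsTopologicalGroup G]
  [CompactSpace G] [MeasurableSpace G] [BorelSpace G] (ρ : G →* Matrix (Fin N) (Fin N) ℂ)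
  (μ : Measure (GaugeConfig d L G)) [IsProbabilityMeasure μ]

/-- **The untrained Wilson sampler is hit-or-miss a.e. iff the Boltzmann tilt is `μ`-trivial**
(`e^{−βS}/Z_μ(β) = 1` `μ`-a.e., i.e. the action is `μ`-a.e. constant). [ours] -/
theorem wilsonIdentityFlow_hitOrMiss_ae_iff (hρ : Continuous ρ) (β : ℝ) :
    (∃ c : ℝ, ∀ᵐ U ∂μ,
        0 < Real.exp (-β * wilsonAction ρ U) / ∫ V, Real.exp (-β * wilsonAction ρ V) ∂μ →
          Real.exp (-β * wilsonAction ρ U) / (∫ V, Real.exp (-β * wilsonAction ρ V) ∂μ) / 1 = c)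
      ↔ (fun U => Real.exp (-β * wilsonAction ρ U) / ∫ V, Real.exp (-β * wilsonAction ρ V) ∂μ)
          =ᵐ[μ] fun _ => (1 : ℝ) :=
  hitOrMiss_ae_iff_ae_eq_of_pos (q := fun _ => (1 : ℝ))
    (fun U => div_pos (Real.exp_pos _) (wilsonZI_pos ρ μ hρ β)) (integral_wilsonD ρ μ hρ β)
    (fun _ => one_pos) (by rw [integral_const, probReal_univ, one_smul])

/-- **`ESS = Z(β)²/Z(2β) < 1` iff the tilt is not `μ`-trivial.** [ours] -/
theorem wilsonIdentityFlow_essFrac_lt_one_iff (hρ : Continuous ρ) (β : ℝ) :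
    (∫ V, Real.exp (-β * wilsonAction ρ V) ∂μ) ^ 2 / ∫ U, Real.exp (-(2 * β) * wilsonAction ρ U) ∂μ
        < 1 ↔
      ¬ ((fun U => Real.exp (-β * wilsonAction ρ U) / ∫ V, Real.exp (-β * wilsonAction ρ V) ∂μ)
          =ᵐ[μ] fun _ => (1 : ℝ)) := by
  set Z : ℝ := ∫ V, Real.exp (-β * wilsonAction ρ V) ∂μ with hZdef
  have hZ : 0 < Z := wilsonZI_pos ρ μ hρ β
  have hZ2 : 0 < ∫ U, Real.exp (-(2 * β) * wilsonAction ρ U) ∂μ := wilsonZI_pos ρ μ hρ (2 * β)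
  have hq1 : ∫ _U, (1 : ℝ) ∂μ = 1 := by rw [integral_const, probReal_univ, one_smul]
  have hW : Integrable (fun U : GaugeConfig d L G =>
      (Real.exp (-β * wilsonAction ρ U) / Z) ^ 2 / 1) μ := by
    simp_rw [div_one, div_pow, exp_neg_mul_wilsonAction_sq]
    exact (integrable_exp_mul_wilsonAction ρ hρ _ _).div_const _
  have key := one_lt_integral_sq_div_iff (μ := μ) (integrable_wilsonD ρ μ hρ β Z)
    (integral_wilsonD ρ μ hρ β) (fun _ => one_pos) (integrable_const _) hq1 hW
  simp_rw [div_one] at key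
  rw [integral_wilsonD_sq ρ μ] at key
  rw [← key, div_lt_one hZ2, one_lt_div (pow_pos hZ 2)]

/-- **STRICT BHATTACHARYYA CEILING FOR THE UNTRAINED WILSON SAMPLER**: if the Boltzmann tilt is not
`μ`-trivial then `∫∫ min(p(U), p(U′)) dμ dμ < Z(β/2)²/Z(β)`, for every compact `G`, continuous `ρ`,
`d`, `L`, `β` and reference probability law `μ`. [ours] -/
theorem wilsonIdentityFlow_meanAccept_lt (hρ : Continuous ρ) (β : ℝ)
    (h : ¬ ((fun U => Real.exp (-β * wilsonAction ρ U) / ∫ V, Real.exp (-β * wilsonAction ρ V) ∂μ)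
      =ᵐ[μ] fun _ => (1 : ℝ))) :
    ∫ U, ∫ U', min (Real.exp (-β * wilsonAction ρ U) / ∫ V, Real.exp (-β * wilsonAction ρ V) ∂μ)
        (Real.exp (-β * wilsonAction ρ U') / ∫ V, Real.exp (-β * wilsonAction ρ V) ∂μ) ∂μ ∂μ
      < (∫ U, Real.exp (-(β / 2) * wilsonAction ρ U) ∂μ) ^ 2
          / ∫ V, Real.exp (-β * wilsonAction ρ V) ∂μ := by
  set Z : ℝ := ∫ V, Real.exp (-β * wilsonAction ρ V) ∂μ with hZdef
  have hZ : 0 < Z := wilsonZI_pos ρ μ hρ β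
  have hne : ¬ ∃ c : ℝ, ∀ᵐ U ∂μ, 0 < Real.exp (-β * wilsonAction ρ U) / Z →
      Real.exp (-β * wilsonAction ρ U) / Z / 1 = c :=
    fun hc => h ((wilsonIdentityFlow_hitOrMiss_ae_iff ρ μ hρ β).1 hc)
  have hlt := meanAccept_lt_sq_integral_sqrt (μ := μ)
    (fun U => (div_pos (Real.exp_pos _) hZ).le) (measurable_wilsonD ρ hρ β Z)
    (integrable_wilsonD ρ μ hρ β Z) (integral_wilsonD ρ μ hρ β) (fun _ => one_pos) measurable_const
    (integrable_const _) hne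
  simp_rw [mul_one] at hlt
  rw [integral_sqrt_wilsonD ρ μ hρ, div_pow, Real.sq_sqrt hZ.le] at hlt
  exact hlt


/-! ### The product Haar reference law: non-triviality is unconditional -/

/-- **THE BOLTZMANN TILT OF THE PRODUCT HAAR LAW IS NON-TRIVIAL** as soon as `β ≠ 0` and the action
is not identically zero: the a.e. equation `e^{−βS}/Z = 1` would make the continuous action a.e.
equal to the constant `−log Z/β`, but `{S ≠ const}` is a non-empty open set (it contains the trivial
configuration, `S(1) = 0`, or the given `U₀`) and product Haar measure charges open sets. [ours] -/
theorem wilsonTilt_not_ae_one_haar (hρ : Continuous ρ) {β : ℝ} (hβ : β ≠ 0)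
    (hS : ∃ U₀ : GaugeConfig d L G, wilsonAction ρ U₀ ≠ 0) :
    ¬ ((fun U => Real.exp (-β * wilsonAction ρ U) / ∫ V, Real.exp (-β * wilsonAction ρ V)
          ∂(Measure.pi fun _ : Edge d L => haarProbability G))
        =ᵐ[Measure.pi fun _ : Edge d L => haarProbability G] fun _ => (1 : ℝ)) := by
  haveI : (haarProbability G).IsOpenPosMeasure := by unfold haarProbability; infer_instance
  set ν : Measure (GaugeConfig d L G) := Measure.pi fun _ : Edge d L => haarProbability G with hν
  set Z : ℝ := ∫ V, Real.exp (-β * wilsonAction ρ V) ∂ν with hZdef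
  have hZ : 0 < Z := wilsonZI_pos ρ ν hρ β
  intro h
  set c : ℝ := Real.log Z / (-β) with hc
  have hSc : ∀ᵐ U ∂ν, wilsonAction ρ U = c := h.mono fun U hU => by
    have h1 : Real.exp (-β * wilsonAction ρ U) = Z := by rwa [div_eq_one_iff_eq hZ.ne'] at hU
    have h2 : -β * wilsonAction ρ U = Real.log Z := by rw [← h1, Real.log_exp]
    rw [hc, eq_div_iff (neg_ne_zero.2 hβ), mul_comm]
    exact h2
  obtain ⟨U₀, hU₀⟩ := hS
  have hopen : IsOpen {U : GaugeConfig d L G | wilsonAction ρ U ≠ c} :=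
    isOpen_ne_fun (continuous_wilsonAction_of_continuous ρ hρ) continuous_const
  have hne : ({U : GaugeConfig d L G | wilsonAction ρ U ≠ c}).Nonempty := by
    by_cases hc0 : c = 0
    · exact ⟨U₀, by rw [Set.mem_setOf_eq, hc0]; exact hU₀⟩
    · exact ⟨1, by rw [Set.mem_setOf_eq, wilsonAction_one_eq_zero]; exact Ne.symm hc0⟩
  exact (hopen.measure_pos ν hne).ne' (ae_iff.1 hSc)

/-- **`Z(β)² < Z(2β)`, i.e. `ESS < 1`, for the untrained sampler of every Wilson theory whose action is
not identically zero, `β ≠ 0`** (`Z = (partitionFunction ρ ·).toReal`, reference law `Haar^{⊗E}`).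
[ours] -/
theorem wilsonIdentityFlow_essFrac_lt_one_haar (hρ : Continuous ρ) {β : ℝ} (hβ : β ≠ 0)
    (hS : ∃ U₀ : GaugeConfig d L G, wilsonAction ρ U₀ ≠ 0) :
    (partitionFunction (d := d) (L := L) ρ β).toReal ^ 2
        / (partitionFunction (d := d) (L := L) ρ (2 * β)).toReal < 1 := by
  rw [partitionFunction_toReal_eq_integral ρ hρ, partitionFunction_toReal_eq_integral ρ hρ]
  exact (wilsonIdentityFlow_essFrac_lt_one_iff ρ _ hρ β).2 (wilsonTilt_not_ae_one_haar ρ hρ hβ hS)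

/-- **STRICT CEILING FOR THE UNTRAINED SAMPLER OF EVERY WILSON THEORY** (`μ = Haar^{⊗E}`, action not
identically zero, `β ≠ 0`): `acc < Z(β/2)²/Z(β)`, `Z = (partitionFunction ρ ·).toReal`. [ours] -/
theorem wilsonIdentityFlow_meanAccept_lt_haar (hρ : Continuous ρ) {β : ℝ} (hβ : β ≠ 0)
    (hS : ∃ U₀ : GaugeConfig d L G, wilsonAction ρ U₀ ≠ 0) :
    ∫ U, ∫ U', min (Real.exp (-β * wilsonAction ρ U) / ∫ V, Real.exp (-β * wilsonAction ρ V)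
            ∂(Measure.pi fun _ : Edge d L => haarProbability G))
        (Real.exp (-β * wilsonAction ρ U') / ∫ V, Real.exp (-β * wilsonAction ρ V)
            ∂(Measure.pi fun _ : Edge d L => haarProbability G))
        ∂(Measure.pi fun _ : Edge d L => haarProbability G)
        ∂(Measure.pi fun _ : Edge d L => haarProbability G)
      < (partitionFunction (d := d) (L := L) ρ (β / 2)).toReal ^ 2
          / (partitionFunction (d := d) (L := L) ρ β).toReal := by
  rw [partitionFunction_toReal_eq_integral ρ hρ, partitionFunction_toReal_eq_integral ρ hρ]
  exact wilsonIdentityFlow_meanAccept_lt ρ _ hρ β (wilsonTilt_not_ae_one_haar ρ hρ hβ hS)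

end Wilson

/-! ## §3 Independent U(1) plaquettes at `β ≠ 0`: unconditionally graded -/

section U1

variable {ι : Type*} [Fintype ι]

/-- **The Wilson one-plaquette pair is NOT hit-or-miss a.e.** for `β ≠ 0`. [ours] -/
theorem not_hitOrMiss_u1Wilson {β : ℝ} (hβ : β ≠ 0) :
    ¬ ∃ c : ℝ, ∀ᵐ θ ∂(volume.restrict (Ioc (0 : ℝ) (2 * π))),
      0 < Real.exp (β * Real.cos θ) / onePlaquetteZ β →
        Real.exp (β * Real.cos θ) / onePlaquetteZ β / (1 / (2 * π)) = c :=
  not_hitOrMiss_ae_of_not_ae_eq (u1Wilson_pos β) (integral_u1Wilson β) (fun _ => by positivity)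
    integral_u1Haar (not_u1Wilson_ae_eq_u1Haar hβ)

/-- **One plaquette, strict ceiling**: `acc₁ < I₀(β/2)²/I₀(β)` for `β ≠ 0`. [ours] -/
theorem u1IdentityFlow_meanAccept_one_lt {β : ℝ} (hβ : β ≠ 0) :
    ∫ θ in Ioc (0 : ℝ) (2 * π), ∫ θ' in Ioc (0 : ℝ) (2 * π),
        min (Real.exp (β * Real.cos θ) / onePlaquetteZ β * (1 / (2 * π)))
          (Real.exp (β * Real.cos θ') / onePlaquetteZ β * (1 / (2 * π)))
      < besselI 0 (β / 2) ^ 2 / besselI 0 β := by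
  have h := meanAccept_lt_sq_integral_sqrt (μ := volume.restrict (Ioc (0 : ℝ) (2 * π)))
    (fun θ => (u1Wilson_pos β θ).le) (measurable_u1Wilson β) (integrable_u1Wilson β)
    (integral_u1Wilson β) (fun _ => by positivity) measurable_const integrable_u1Haar
    (not_hitOrMiss_u1Wilson hβ)
  rw [integral_sqrt_u1Wilson_mul, div_pow, Real.sq_sqrt (besselI_zero_pos β).le] at h
  exact h

/-- **`V ≥ 1` plaquettes, STRICT CEILING**: `acc_V < (I₀(β/2)²/I₀(β))^V` for `β ≠ 0` — the untrained
U(1) sampler lies strictly inside GEN-12's sandwich. [ours] -/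
theorem u1IdentityFlow_meanAccept_lt_pow [Nonempty ι] {β : ℝ} (hβ : β ≠ 0) :
    ∫ x, ∫ x', min ((∏ i : ι, Real.exp (β * Real.cos (x i)) / onePlaquetteZ β)
          * ∏ _i : ι, (1 / (2 * π) : ℝ))
        ((∏ i : ι, Real.exp (β * Real.cos (x' i)) / onePlaquetteZ β) * ∏ _i : ι, (1 / (2 * π) : ℝ))
        ∂(Measure.pi fun _ : ι => volume.restrict (Ioc (0 : ℝ) (2 * π)))
        ∂(Measure.pi fun _ : ι => volume.restrict (Ioc (0 : ℝ) (2 * π)))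
      < (besselI 0 (β / 2) ^ 2 / besselI 0 β) ^ Fintype.card ι := by
  have h := meanAccept_pi_const_lt_pow (ι := ι) (ν := volume.restrict (Ioc (0 : ℝ) (2 * π)))
    (fun θ => (u1Wilson_pos β θ).le) (measurable_u1Wilson β) (integrable_u1Wilson β)
    (integral_u1Wilson β) (fun _ => by positivity) measurable_const integrable_u1Haar
    (not_hitOrMiss_u1Wilson hβ)
  rw [integral_sqrt_u1Wilson_mul, div_pow, Real.sq_sqrt (besselI_zero_pos β).le] at h
  exact h

/-- **`V ≥ 2` plaquettes, STRICT FLOOR**: `acc₁^V < acc_V` for `β ≠ 0` — the untrained acceptance is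
strictly super-multiplicative in the volume. [ours] -/
theorem u1IdentityFlow_pow_meanAccept_lt {β : ℝ} (hβ : β ≠ 0) (hV : 1 < Fintype.card ι) :
    (∫ θ in Ioc (0 : ℝ) (2 * π), ∫ θ' in Ioc (0 : ℝ) (2 * π),
        min (Real.exp (β * Real.cos θ) / onePlaquetteZ β * (1 / (2 * π)))
          (Real.exp (β * Real.cos θ') / onePlaquetteZ β * (1 / (2 * π)))) ^ Fintype.card ι
      < ∫ x, ∫ x', min ((∏ i : ι, Real.exp (β * Real.cos (x i)) / onePlaquetteZ β)
            * ∏ _i : ι, (1 / (2 * π) : ℝ))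
          ((∏ i : ι, Real.exp (β * Real.cos (x' i)) / onePlaquetteZ β)
            * ∏ _i : ι, (1 / (2 * π) : ℝ))
          ∂(Measure.pi fun _ : ι => volume.restrict (Ioc (0 : ℝ) (2 * π)))
          ∂(Measure.pi fun _ : ι => volume.restrict (Ioc (0 : ℝ) (2 * π))) := by
  classical
  obtain ⟨j, k, hjk⟩ := Fintype.exists_pair_of_one_lt_card hV
  have h := prod_meanAccept_lt_meanAccept_pi (ι := ι) (X := fun _ => ℝ)
    (μ := fun _ : ι => volume.restrict (Ioc (0 : ℝ) (2 * π)))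
    (p := fun _ θ => Real.exp (β * Real.cos θ) / onePlaquetteZ β) (q := fun _ _ => (1 / (2 * π) : ℝ))
    (fun _ θ => (u1Wilson_pos β θ).le) (fun _ => measurable_u1Wilson β)
    (fun _ => integrable_u1Wilson β) (fun _ => integral_u1Wilson β) (fun _ _ => by positivity)
    (fun _ => measurable_const) (fun _ => integrable_u1Haar) hjk (not_hitOrMiss_u1Wilson hβ)
    (not_hitOrMiss_u1Wilson hβ)
  rwa [prod_const, card_univ] at h

end U1

end Summit.Ventures.LatticeQCDFlow.Theory2
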